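/-
Copyright (c) 2026 the pub-hodgecm-mathlib formalisation cell (harness21).  Prover seat hodgecm-mathlib-R90-C131-p02 (g0) (R90-TF S4 hand lent to L1
by CHAIR VALVE WORD W4), Track B «K2-LIT», hLiu418 = `stmt-HodgeConjecture-24832`; K1-a♮ line lead K2E5-p16 (g8) WORD #9 (1) «(Φ-S1) ROAD B, file (ii)».
THEOREMS ONLY (no `def`, no instance, no notation, no named-fact hypothesis, no `sorry`); lane `--supports stmt-HodgeConjecture-24832 --as helper`.
-/
import Summits.HodgeConjecture.HodgeConjecture.Theorems.K2LiuHermTwoEtaRankOneContinuation   -- ★ ED. 3b: `differentiableOn_jIntegral_line`, ★ ED. 3a `jIntegral_recursion`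
import Summits.HodgeConjecture.HodgeConjecture.Theorems.K2LiuHermTwoEtaShiftParamSmooth       -- ★ (Φ-S1)(i): `hasDerivAt_jIntegral_param_p`
import HarnessLib

/-!
# Crux `HLiu418`, (Φ-S1) road B, file (ii): the continuation of the rank-one confluent letter `Γ(β−1)⁻¹J_{p,t}(α,β)` carried JOINTLY in the
# weight parameter `p` — ONE witness per depth, closed under the three-term recursion AND under `∂_p`:  `∂_p Φ(α₀,β₀) = −(β₀+s−1)·Φ(α₀,β₀+1)`

Cell `hodgecm-mathlib`, crux item hLiu418 = `stmt-HodgeConjecture-24832` (helper lane, count-neutral).  ★ ED. 3b `exists_continuation_jIntegral_line`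
continues `s ↦ Γ(β₀+s−1)⁻¹J_{p,t}(α₀+s, β₀+s)` to `{1 − N < re(β₀+s)}` for each FIXED `p`; road B of (Φ-S1) differentiates the continued scalar block
★ p863260 in the point `h ∈ U(J)`, which moves the weight parameter `p` (★ ED. 2), so the continuation must be a function of `(p, s)` with a
`p`-derivative that is again holomorphic on the continued strip.  THIS FILE: for `t > 0` and `N : ℕ` there is ONE `Φ_N : ℂ → ℂ → ℝ → ℂ → ℂ`
(`(α₀, β₀, p, s) ↦ Φ_N`) such that for every `α₀ β₀` and `p > 0`:
(a) `Φ_N α₀ β₀ p` is holomorphic on `S_N(β₀) = {1 − N < re(β₀+s)}`; (b) it is `Γ(β₀+s−1)⁻¹J_{p,t}(α₀+s,β₀+s)` on `{1 < re(β₀+s)}`;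
(c) the recursion `Φ_N α₀ β₀ p s = p·Φ_N α₀ (β₀+1) p s − (α₀+s−2)·Φ_N (α₀−1) (β₀+1) p s` holds on `S_N(β₀)`; and
(d) **`∂_p Φ_N α₀ β₀ p s = −(β₀+s−1)·Φ_N α₀ (β₀+1) p s` on `S_N(β₀)`** (a `HasDerivAt` in the real variable `p`) — the `p`-derivative of a
continued letter is a continued letter, on the whole strip.  Induction on `N` (`Φ₀ := Γ(β₀+s−1)⁻¹J`, `Φ_{N+1} α₀ β₀ p s := p·Φ_N α₀(β₀+1) p s −
(α₀+s−2)·Φ_N(α₀−1)(β₀+1) p s`); (c) base = ★ `jIntegral_recursion`, (c) step = algebra from (c)_N at the two shifted parameters; (d) base = ★(i)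
`hasDerivAt_jIntegral_param_p`, (d) step = product rule + (d)_N, the defect being (c)_N at `(α₀, β₀+1)`.  No identity theorem.
* §1 `base_recursion`, `base_hasDerivAt`; §2 **`exists_continuation_jIntegral_param`**.

HONEST LABEL: analytic letters; closes no socket.  HC_CM is proved only modulo the 7 printed citations (2 remaining named inputs: hLiu418 =
`stmt-HodgeConjecture-24832`, h413 = `stmt-HodgeConjecture-24833`) until rung 0 closes.  REL ≠ ★ ≠ BUILT.

## References
* [Shimura1982] G. Shimura, *Confluent hypergeometric functions on tube domains*, Math. Ann. 260 (1982), §3 Thm. 3.1, §4 Thm. 4.2.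
* [Shimura1997] G. Shimura, *Euler Products and Eisenstein Series*, CBMS 93 (1997), §16.4, §18.4–18.5.
-/

set_option autoImplicit false
set_option linter.dupNamespace false

noncomputable section

open Complex MeasureTheory Set Filter
open scoped Topology

namespace Summit.HodgeConjecture.HodgeConjecture.Cruxes.HLiu418.K2LiuArchTwistedScalarBlockParamSmooth

open Summit.HodgeConjecture.HodgeConjecture.Cruxes.HLiu418.K2LiuHermTwoEtaRankOneLetter
open Summit.HodgeConjecture.HodgeConjecture.Cruxes.HLiu418.K2LiuHermTwoEtaRankOneContinuation
open Summit.HodgeConjecture.HodgeConjecture.Cruxes.HLiu418.K2LiuHermTwoEtaShiftParamSmooth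

/-! ## §1 The base of the induction: the recursion and the `p`-derivative of `Γ(β−1)⁻¹J` -/

/-- The three-term recursion of ★ ED. 3a in the `Γ(β−1)⁻¹`-normalised, `(α₀, β₀, s)`-parametrised shape:
`Γ(β₀+s−1)⁻¹J(α₀+s,β₀+s) = p·Γ(β₀+1+s−1)⁻¹J(α₀+s, β₀+1+s) − (α₀+s−2)·Γ(β₀+1+s−1)⁻¹J(α₀−1+s, β₀+1+s)` for `1 < re(β₀+s)`. [Shimura1982, §3 Thm. 3.1] -/
theorem base_recursion {p t : ℝ} (hp : 0 < p) (ht : 0 < t) (α₀ β₀ : ℂ) {s : ℂ} (hs : 1 < (β₀ + s).re) :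
    (Complex.Gamma (β₀ + s - 1))⁻¹ *
        ∫ r in Ioi (0 : ℝ), cexp (-((p * r : ℝ) : ℂ)) * ((((r + 2 * t : ℝ)) : ℂ) ^ (α₀ + s - 2) * ((r : ℝ) : ℂ) ^ (β₀ + s - 2)) =
      (p : ℂ) * ((Complex.Gamma (β₀ + 1 + s - 1))⁻¹ *
        ∫ r in Ioi (0 : ℝ), cexp (-((p * r : ℝ) : ℂ)) * ((((r + 2 * t : ℝ)) : ℂ) ^ (α₀ + s - 2) * ((r : ℝ) : ℂ) ^ (β₀ + 1 + s - 2))) -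
      (α₀ + s - 2) * ((Complex.Gamma (β₀ + 1 + s - 1))⁻¹ *
        ∫ r in Ioi (0 : ℝ), cexp (-((p * r : ℝ) : ℂ)) * ((((r + 2 * t : ℝ)) : ℂ) ^ (α₀ - 1 + s - 2) * ((r : ℝ) : ℂ) ^ (β₀ + 1 + s - 2))) := by
  have hβ1 : β₀ + s - 1 ≠ 0 := fun h => by
    have := congrArg Complex.re h; simp only [sub_re, add_re, one_re, zero_re] at this hs; linarith
  have hrec := jIntegral_recursion hp ht (α₀ + s) (β := β₀ + s) hs
  have e1 : β₀ + 1 + s - 1 = (β₀ + s - 1) + 1 := by ring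
  have e2 : β₀ + 1 + s - 2 = β₀ + s + 1 - 2 := by ring
  have e3 : α₀ - 1 + s - 2 = α₀ + s - 1 - 2 := by ring
  rw [e1, Complex.Gamma_add_one _ hβ1]
  simp only [e2, e3]
  have hinv : ((β₀ + s - 1) * Complex.Gamma (β₀ + s - 1))⁻¹ = (Complex.Gamma (β₀ + s - 1))⁻¹ * (β₀ + s - 1)⁻¹ := by
    rw [mul_inv, mul_comm]
  rw [hinv]
  have hJ : (∫ r in Ioi (0 : ℝ), cexp (-((p * r : ℝ) : ℂ)) * ((((r + 2 * t : ℝ)) : ℂ) ^ (α₀ + s - 2) * ((r : ℝ) : ℂ) ^ (β₀ + s - 2))) =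
      (β₀ + s - 1)⁻¹ * ((p : ℂ) * (∫ r in Ioi (0 : ℝ), cexp (-((p * r : ℝ) : ℂ)) * ((((r + 2 * t : ℝ)) : ℂ) ^ (α₀ + s - 2) * ((r : ℝ) : ℂ) ^ (β₀ + s + 1 - 2))) -
        (α₀ + s - 2) * (∫ r in Ioi (0 : ℝ), cexp (-((p * r : ℝ) : ℂ)) * ((((r + 2 * t : ℝ)) : ℂ) ^ (α₀ + s - 1 - 2) * ((r : ℝ) : ℂ) ^ (β₀ + s + 1 - 2)))) := by
    rw [← hrec, ← mul_assoc, inv_mul_cancel₀ hβ1, one_mul]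
  rw [hJ]
  ring

/-- The `p`-derivative of the base letter: for `p, t > 0` and `1 < re(β₀+s)`,
`∂_p [Γ(β₀+s−1)⁻¹J_{p,t}(α₀+s,β₀+s)] = −(β₀+s−1)·Γ(β₀+1+s−1)⁻¹J_{p,t}(α₀+s, β₀+1+s)` (★(i) `hasDerivAt_jIntegral_param_p`, `Γ(β) = (β−1)Γ(β−1)`).
[Shimura1982, §3] -/
theorem base_hasDerivAt {p t : ℝ} (hp : 0 < p) (ht : 0 < t) (α₀ β₀ : ℂ) {s : ℂ} (hs : 1 < (β₀ + s).re) :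
    HasDerivAt (fun p' : ℝ => (Complex.Gamma (β₀ + s - 1))⁻¹ *
        ∫ r in Ioi (0 : ℝ), cexp (-((p' * r : ℝ) : ℂ)) * ((((r + 2 * t : ℝ)) : ℂ) ^ (α₀ + s - 2) * ((r : ℝ) : ℂ) ^ (β₀ + s - 2)))
      (-(β₀ + s - 1) * ((Complex.Gamma (β₀ + 1 + s - 1))⁻¹ *
        ∫ r in Ioi (0 : ℝ), cexp (-((p * r : ℝ) : ℂ)) * ((((r + 2 * t : ℝ)) : ℂ) ^ (α₀ + s - 2) * ((r : ℝ) : ℂ) ^ (β₀ + 1 + s - 2)))) p := by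
  have hβ1 : β₀ + s - 1 ≠ 0 := fun h => by
    have := congrArg Complex.re h; simp only [sub_re, add_re, one_re, zero_re] at this hs; linarith
  have h := (hasDerivAt_jIntegral_param_p hp ht (α₀ + s) (β := β₀ + s) hs).const_mul ((Complex.Gamma (β₀ + s - 1))⁻¹)
  refine h.congr_deriv ?_
  have e1 : β₀ + 1 + s - 1 = (β₀ + s - 1) + 1 := by ring
  have e2 : β₀ + 1 + s - 2 = β₀ + s + 1 - 2 := by ring
  rw [e1, Complex.Gamma_add_one _ hβ1, e2, mul_inv, mul_neg, neg_mul, ← mul_assoc, ← mul_assoc, mul_inv_cancel₀ hβ1, one_mul]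

/-! ## §2 The joint continuation, closed under the recursion and under `∂_p` -/

/-- **THE CONTINUED RANK-ONE LETTER AS A FUNCTION OF `(α₀, β₀, p, s)`, CLOSED UNDER THE RECURSION AND UNDER `∂_p`.**  For `t > 0` and `N : ℕ`
there is `Φ : ℂ → ℂ → ℝ → ℂ → ℂ` such that for all `α₀ β₀` and `p > 0`: (a) `Φ α₀ β₀ p` is holomorphic on `{1 − N < re(β₀+s)}`; (b) it equals
`Γ(β₀+s−1)⁻¹·∫₀^∞ e^{−pr}(r+2t)^{α₀+s−2}r^{β₀+s−2}dr` on `{1 < re(β₀+s)}`; (c) `Φ α₀ β₀ p s = p·Φ α₀ (β₀+1) p s − (α₀+s−2)·Φ (α₀−1) (β₀+1) p s`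
on `{1 − N < re(β₀+s)}`; (d) `∂_p Φ α₀ β₀ p s = −(β₀+s−1)·Φ α₀ (β₀+1) p s` on `{1 − N < re(β₀+s)}`.
[Shimura1982, §3 Thm. 3.1, §4 Thm. 4.2] [Shimura1997, §18.4] -/
theorem exists_continuation_jIntegral_param {t : ℝ} (ht : 0 < t) (N : ℕ) :
    ∃ Φ : ℂ → ℂ → ℝ → ℂ → ℂ,
      (∀ (α₀ β₀ : ℂ) (p : ℝ), 0 < p → DifferentiableOn ℂ (Φ α₀ β₀ p) {s : ℂ | 1 - N < (β₀ + s).re}) ∧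
      (∀ (α₀ β₀ : ℂ) (p : ℝ), 0 < p → ∀ s : ℂ, 1 < (β₀ + s).re → Φ α₀ β₀ p s = (Complex.Gamma (β₀ + s - 1))⁻¹ *
        ∫ r in Ioi (0 : ℝ), cexp (-((p * r : ℝ) : ℂ)) * ((((r + 2 * t : ℝ)) : ℂ) ^ (α₀ + s - 2) * ((r : ℝ) : ℂ) ^ (β₀ + s - 2))) ∧
      (∀ (α₀ β₀ : ℂ) (p : ℝ), 0 < p → ∀ s : ℂ, 1 - N < (β₀ + s).re →
        Φ α₀ β₀ p s = (p : ℂ) * Φ α₀ (β₀ + 1) p s - (α₀ + s - 2) * Φ (α₀ - 1) (β₀ + 1) p s) ∧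
      (∀ (α₀ β₀ : ℂ) (p : ℝ), 0 < p → ∀ s : ℂ, 1 - N < (β₀ + s).re →
        HasDerivAt (fun p' : ℝ => Φ α₀ β₀ p' s) (-(β₀ + s - 1) * Φ α₀ (β₀ + 1) p s) p) := by
  induction N with
  | zero =>
    refine ⟨fun α₀ β₀ p s => (Complex.Gamma (β₀ + s - 1))⁻¹ *
        ∫ r in Ioi (0 : ℝ), cexp (-((p * r : ℝ) : ℂ)) * ((((r + 2 * t : ℝ)) : ℂ) ^ (α₀ + s - 2) * ((r : ℝ) : ℂ) ^ (β₀ + s - 2)),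
      ?_, fun _ _ _ _ _ _ => rfl, ?_, ?_⟩
    · intro α₀ β₀ p hp
      have hG : Differentiable ℂ (fun s : ℂ => (Complex.Gamma (β₀ + s - 1))⁻¹) :=
        Complex.differentiable_one_div_Gamma.comp (((differentiable_id).const_add β₀).sub_const 1)
      have h := (hG.differentiableOn).mul (differentiableOn_jIntegral_line hp ht α₀ β₀)
      simp only [Nat.cast_zero, sub_zero]
      exact h
    · intro α₀ β₀ p hp s hs
      simp only [Nat.cast_zero, sub_zero] at hs
      exact base_recursion hp ht α₀ β₀ hs
    · intro α₀ β₀ p hp s hs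
      simp only [Nat.cast_zero, sub_zero] at hs
      exact base_hasDerivAt hp ht α₀ β₀ hs
  | succ N ih =>
    obtain ⟨Φ, ha, hb, hc, hd⟩ := ih
    refine ⟨fun α₀ β₀ p s => (p : ℂ) * Φ α₀ (β₀ + 1) p s - (α₀ + s - 2) * Φ (α₀ - 1) (β₀ + 1) p s, ?_, ?_, ?_, ?_⟩
    · -- (a) holomorphy on `S_{N+1}(β₀) = S_N(β₀+1)`
      intro α₀ β₀ p hp
      have hsub : {s : ℂ | 1 - ((N + 1 : ℕ) : ℝ) < (β₀ + s).re} ⊆ {s : ℂ | 1 - (N : ℝ) < (β₀ + 1 + s).re} := by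
        intro s hs
        simp only [mem_setOf_eq, add_re, one_re, Nat.cast_add, Nat.cast_one] at hs ⊢
        linarith
      have hlin : Differentiable ℂ (fun s : ℂ => α₀ + s - 2) := ((differentiable_id).const_add α₀).sub_const 2
      exact ((differentiableOn_const _).mul ((ha α₀ (β₀ + 1) p hp).mono hsub)).sub
        (hlin.differentiableOn.mul ((ha (α₀ - 1) (β₀ + 1) p hp).mono hsub))
    · -- (b) agreement on `{1 < re(β₀+s)}`
      intro α₀ β₀ p hp s hs
      have hs1 : 1 < (β₀ + 1 + s).re := by simp only [add_re, one_re] at hs ⊢; linarith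
      simp only
      rw [hb α₀ (β₀ + 1) p hp s hs1, hb (α₀ - 1) (β₀ + 1) p hp s hs1]
      exact (base_recursion hp ht α₀ β₀ hs).symm
    · -- (c) the recursion inside the family
      intro α₀ β₀ p hp s hs
      have hs1 : 1 - (N : ℝ) < (β₀ + 1 + s).re := by
        simp only [add_re, one_re, Nat.cast_add, Nat.cast_one] at hs ⊢; linarith
      simp only
      rw [hc α₀ (β₀ + 1) p hp s hs1, hc (α₀ - 1) (β₀ + 1) p hp s hs1]
    · -- (d) the `p`-derivative inside the family
      intro α₀ β₀ p hp s hs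
      have hs1 : 1 - (N : ℝ) < (β₀ + 1 + s).re := by
        simp only [add_re, one_re, Nat.cast_add, Nat.cast_one] at hs ⊢; linarith
      have h1 := hd α₀ (β₀ + 1) p hp s hs1
      have h2 := hd (α₀ - 1) (β₀ + 1) p hp s hs1
      have hid : HasDerivAt (fun p' : ℝ => ((p' : ℝ) : ℂ)) 1 p := by
        have h := (hasDerivAt_id p).ofReal_comp
        simp only [id_eq, ofReal_one] at h
        exact h
      have hprod := hid.mul h1
      have htot := hprod.sub (h2.const_mul (α₀ + s - 2))
      simp only
      refine htot.congr_deriv ?_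
      rw [hc α₀ (β₀ + 1) p hp s hs1]
      ring

end Summit.HodgeConjecture.HodgeConjecture.Cruxes.HLiu418.K2LiuArchTwistedScalarBlockParamSmooth

end
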